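import Literature.Barriers.AnomalousDissipation.ShearFlowViscositySelection
import Literature.Analysis.FluidPDE.NSHopfExistenceProofs
import Literature.Analysis.FluidPDE.NSHopfLimit
import Literature.Analysis.FunctionSpaces.TorusAxisAverage
import HarnessLib

/-!
# Bardos–Titi–Wiedemann 2012, Thm. 5 — proof architecture, part 1: existence (proved via
Hopf), and the two printed sub-claims vendored as named facts

Companion to `Literature/Barriers/AnomalousDissipation/ShearFlowViscositySelection.lean`, whose
named fact `BardosTitiWiedemann2012_thm5` (Bardos–Titi–Wiedemann, C. R. Math. 350 (2012), Thm. 5)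
asserts, for shear data `v₀ = (v₁(x₂), 0, v₃(x₁,x₂))`, `v₁ ∈ L²(T)`, `v₃ ∈ L²(T²)`, on
`T³ × [0,T)`: (i) existence of a Leray–Hopf solution for every `ν > 0`, (ii) its uniqueness among
all Leray–Hopf solutions, (iii) weak-* convergence of the Leray–Hopf solutions to the shear flow
as `ν → 0`.

The printed proof (op. cit., proof of Thm. 5, and Lemma 4) runs: the ansatz
`u^ν = (u₁^ν(x₂,t), 0, u₃^ν(x₁,x₂,t))`, `p = 0` reduces Navier–Stokes to the heat equation for
`u₁^ν` and an advection–diffusion equation for `u₃^ν` ("two-and-half Navier–Stokes equations"),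
globally well posed, giving a Leray–Hopf solution; "following ideas from [Serrin] (see, e.g.,
[BLNNT] and [Iftimie-Raugel] for details) one can show that this solution is unique within the
class of all 3D Leray-Hopf weak solutions"; bounded in `L^∞_t L²_x`, subsequences converge weak-*
to a solution of the linear transport system (6), `u₁^ν → v₁` strongly (heat equation), and
Lemma 4 (uniqueness for `∂ₜw + v(x₂)∂₁w = 0` in `L^∞(0,T;L²)`) identifies the limit as the shear
flow, so the whole family converges.

## This file

* `memLp_shearData`, `isWeaklyDivFree_shearData` — the shear datum is an admissible
  Leray–Hopf datum: `v₀ ∈ L²(T³)` (Fubini along the measure-preserving coordinate projections)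
  and `v₀` is weakly divergence free (its Fourier coefficients are transversal, `k · v̂₀(k) = 0`,
  because the first component has no modes with `k₁ ≠ 0` and the third none with `k₃ ≠ 0`,
  `Torus.mFourierCoeff_eq_zero_of_forall_add_single`; then RRS 2016, Lemma 2.3 in the form
  `Torus.isWeaklyDivFree_of_sum_mul_mFourierCoeff_eq_zero`).
* `BardosTitiWiedemann2012_thm5_existence` — **proved**: part (i), existence of a Leray–Hopf
  solution with shear datum for every `ν > 0` and `T > 0`, from Hopf's existence theorem on `T³`
  (`NS.hopf_existence_torus_holds`, proved in the tree) — the printed proof obtains it from the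
  ansatz instead; either way it is a theorem here.
* `BardosTitiWiedemann2012_thm5_uniqueness` — named fact: part (ii) as printed (uniqueness
  within the class of all 3-D Leray–Hopf weak solutions; op. cit. Thm. 5, proof by reference to
  Serrin 1963 and Bardos–Lopes Filho–Niu–Nussenzveig Lopes–Titi 2013, Thm. 3.1 / Rem. 3.1, the
  anisotropic Ladyzhenskaya estimate for `x₃`-independent reference solutions). This is the deep
  input (a weak–strong uniqueness theorem *off* the Prodi–Serrin scale); discharged in
  `ShearFlowViscositySelectionStepsProofs` (`BardosTitiWiedemann2012_thm5_uniqueness_holds`).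
* `BardosTitiWiedemann2012_thm5_shearLerayHopf` — named fact: the structural claim of the
  printed proof, "for every fixed `ν > 0`, we obtain a Leray–Hopf weak solution with the initial
  data `v₀`" *of the ansatz form* `(u₁^ν(x₂,t), 0, u₃^ν(x₁,x₂,t))` (op. cit., proof of Thm. 5;
  DiPerna–Majda 1987 for the two-and-a-half-dimensional system); discharged in
  `ShearFlowViscositySelectionStepsProofs` (`BardosTitiWiedemann2012_thm5_shearLerayHopf_holds`).
* `BardosTitiWiedemann2012_thm5_wellposed` — proved assembly of parts (i)–(ii) from the
  uniqueness fact.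

Part (iii) (the vanishing-viscosity limit: weak compactness in `L²`, the heat-flow limit
`u₁^ν → v₁`, Lemma 4, and the sub-subsequence argument) is assembled from these two named facts
in the siblings `ShearFlowViscositySelectionLimit*` and `ShearFlowViscositySelectionAssembly`
(`BardosTitiWiedemann2012_thm5_of_uniqueness`).

## Status (2026-08-15)

Both named facts of this file are DISCHARGED, in `ShearFlowViscositySelectionStepsProofs`:
`BardosTitiWiedemann2012_thm5_shearLerayHopf_holds` (Hopf's Galerkin construction run in the
closed shear class, `Literature.Analysis.FluidPDE.exists_isGlobalLerayHopf_shear`) and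
`BardosTitiWiedemann2012_thm5_uniqueness_holds` (the weak–strong uniqueness theorem for
`x₃`-independent `L²` data, Bardos–Lopes Filho–Niu–Nussenzveig Lopes–Titi 2013, Thm. 3.1 /
Rem. 3.1, proved on `T³` as `Literature.Analysis.FluidPDE.Torus.lerayHopf_ae_eq_of_invariant_datum`
in `Analysis/FluidPDE/NSUniqueness2HalfD`); Thm. 5 as a whole is the theorem
`BardosTitiWiedemann2012_thm5_holds` (`ShearFlowViscositySelectionHolds`), all with axioms
`propext`, `Classical.choice`, `Quot.sound`. The `def … : Prop` statements below are kept because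
the assembly files take them as hypotheses. Barrier audits (D-0021), gens 2–8, all on this file:
CONFIRMED — record and sharpened `scope_caveats` / `evasions_known` in the barrier block of
`ShearFlowViscositySelection.lean` (docstring of `BardosTitiWiedemann2012_thm5`).

## References

* C. Bardos, E. S. Titi, E. Wiedemann, C. R. Math. Acad. Sci. Paris 350 (2012) 757–760, Lemma 4,
  Thm. 5 and its proof (`BardosTitiWiedemann2012`).
* C. Bardos, M. C. Lopes Filho, D. Niu, H. J. Nussenzveig Lopes, E. S. Titi, SIAM J. Math. Anal.
  45 (2013) 1871–1885, Thm. 3.1, Rem. 3.1 (`BardosEtAl2013`).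
* J. Serrin, in *Nonlinear Problems* (Madison 1962), 1963, Thm. 6 (`Serrin1963`).
* E. Hopf, Math. Nachr. 4 (1951) 213–231 (`Hopf1951`); J. C. Robinson, J. L. Rodrigo,
  W. Sadowski, *The three-dimensional Navier–Stokes equations* (2016), Lemma 2.3, Thm. 4.4.
* R. J. DiPerna, A. J. Majda, Comm. Math. Phys. 108 (1987) 667–689 (`DiPernaMajda1987`).
-/

open MeasureTheory Set Filter Topology UnitAddTorus
open scoped ENNReal NNReal

noncomputable section

namespace Literature.Barriers.AnomalousDissipation

/-- The flat three-torus `T³ = (ℝ/ℤ)³` (local notation). -/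
local notation "𝕋³" => UnitAddTorus (Fin 3)
/-- The flat two-torus `T² = (ℝ/ℤ)²` (local notation). -/
local notation "𝕋²" => UnitAddTorus (Fin 2)
/-- Velocity values (local notation). -/
local notation "E³" => EuclideanSpace ℝ (Fin 3)

/-! ## The shear datum is an admissible Leray–Hopf datum -/

/-- The coordinate projection `x ↦ x₂` (index `1`) of `T³` onto `T` preserves the Haar
probability measures (Mathlib `measurePreserving_eval`). [folklore] -/
theorem measurePreserving_eval_one :
    MeasurePreserving (fun x : 𝕋³ => x 1) volume volume :=
  measurePreserving_eval (fun _ : Fin 3 => (volume : Measure UnitAddCircle)) 1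

/-- The coordinate projection `x ↦ (x₁, x₂)` (indices `0, 1`) of `T³` onto `T²` preserves the
Haar probability measures (split off the last coordinate, `measurePreserving_piFinSuccAbove`,
then project, `measurePreserving_snd`). [folklore] -/
theorem measurePreserving_proj₀₁ :
    MeasurePreserving (fun x : 𝕋³ => (![x 0, x 1] : 𝕋²)) volume volume := by
  have h := measurePreserving_piFinSuccAbove (fun _ : Fin 3 => (volume : Measure UnitAddCircle)) 2
  have h2 : MeasurePreserving (Prod.snd : UnitAddCircle × (Fin 2 → UnitAddCircle) → _)
      ((volume : Measure UnitAddCircle).prod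
        (Measure.pi fun _ : Fin 2 => (volume : Measure UnitAddCircle)))
      (Measure.pi fun _ : Fin 2 => (volume : Measure UnitAddCircle)) :=
    measurePreserving_snd
  have h3 := h2.comp h
  refine ⟨?_, ?_⟩
  · exact measurable_pi_lambda _ fun i => by
      fin_cases i <;> exact measurable_pi_apply _
  · have hfun : (fun x : 𝕋³ => (![x 0, x 1] : 𝕋²)) =
        Prod.snd ∘ MeasurableEquiv.piFinSuccAbove (fun _ : Fin 3 => UnitAddCircle) 2 := by
      funext x
      ext j
      fin_cases j <;> rfl
    rw [hfun]
    exact h3.map_eq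

variable {v₁ : UnitAddCircle → ℝ} {v₃ : 𝕋² → ℝ}

/-- The components of the shear datum: `(v₀)₁ = v₁(x₂)`, `(v₀)₂ = 0`, `(v₀)₃ = v₃(x₁,x₂)`. [folklore] -/
theorem shearData_apply (v₁ : UnitAddCircle → ℝ) (v₃ : 𝕋² → ℝ) (x : 𝕋³) :
    shearData v₁ v₃ x 0 = v₁ (x 1) ∧ shearData v₁ v₃ x 1 = 0 ∧
      shearData v₁ v₃ x 2 = v₃ ![x 0, x 1] := by
  simp [shearData]

/-- **The shear datum is square integrable**: `v₀ = (v₁(x₂), 0, v₃(x₁,x₂)) ∈ L²(T³)` for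
`v₁ ∈ L²(T)`, `v₃ ∈ L²(T²)` (componentwise, each component being an `L²` function composed with
a measure-preserving coordinate projection). [folklore] -/
theorem memLp_shearData (hv₁ : MemLp v₁ 2 volume) (hv₃ : MemLp v₃ 2 volume) :
    MemLp (shearData v₁ v₃) 2 volume := by
  have h0 : MemLp (fun x : 𝕋³ => v₁ (x 1)) 2 volume :=
    hv₁.comp_measurePreserving measurePreserving_eval_one
  have h2 : MemLp (fun x : 𝕋³ => v₃ ![x 0, x 1]) 2 volume :=
    hv₃.comp_measurePreserving measurePreserving_proj₀₁
  refine MemLp.of_eval_piLp fun i => ?_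
  fin_cases i
  · simpa [shearData] using h0
  · simp [shearData]
  · simpa [shearData] using h2

/-- The shear datum is invariant under translations along the first axis in its first
component and along the third axis in every component (it does not depend on `x₃`, and its
first component depends on `x₂` only). [folklore] -/
theorem shearData_add_single_two (v₁ : UnitAddCircle → ℝ) (v₃ : 𝕋² → ℝ) (s : UnitAddCircle)
    (x : 𝕋³) : shearData v₁ v₃ (x + Pi.single 2 s) = shearData v₁ v₃ x := by
  simp [shearData]

/-- **The shear datum is weakly divergence free.** Its Fourier coefficients are transversal:
the first component `v₁(x₂)` has no modes with `k₁ ≠ 0`, the second vanishes, the third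
`v₃(x₁,x₂)` has no modes with `k₃ ≠ 0` (`Torus.mFourierCoeff_eq_zero_of_forall_add_single`), so
`∑ⱼ kⱼ (v̂₀)ⱼ(k) = 0` for every `k`, whence `∫ ⟪v₀, ∇θ⟫ = 0` for smooth `θ`
(Robinson–Rodrigo–Sadowski 2016, Lemma 2.3; `Torus.isWeaklyDivFree_of_sum_mul_mFourierCoeff_eq_zero`). [folklore] -/
theorem isWeaklyDivFree_shearData (hv₁ : MemLp v₁ 2 volume) (hv₃ : MemLp v₃ 2 volume) :
    Literature.Analysis.FunctionSpaces.Torus.IsWeaklyDivFree (shearData v₁ v₃) := by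
  classical
  have hmem := memLp_shearData hv₁ hv₃
  refine Literature.Analysis.FluidPDE.Torus.isWeaklyDivFree_of_sum_mul_mFourierCoeff_eq_zero hmem fun k => ?_
  have hint : Integrable (Literature.Analysis.FunctionSpaces.EuclideanSpace.complexify ∘ shearData v₁ v₃) volume :=
    Literature.Analysis.FunctionSpaces.EuclideanSpace.complexify.toContinuousLinearMap.integrable_comp (hmem.integrable one_le_two)
  have hc0 : (fun x : 𝕋³ => (Literature.Analysis.FunctionSpaces.EuclideanSpace.complexify ∘ shearData v₁ v₃) x 0) =
      fun x => ((v₁ (x 1) : ℝ) : ℂ) := by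
    funext x; simp [shearData]
  have hc1 : (fun x : 𝕋³ => (Literature.Analysis.FunctionSpaces.EuclideanSpace.complexify ∘ shearData v₁ v₃) x 1) =
      fun _ => (0 : ℂ) := by
    funext x; simp [shearData]
  have hc2 : (fun x : 𝕋³ => (Literature.Analysis.FunctionSpaces.EuclideanSpace.complexify ∘ shearData v₁ v₃) x 2) =
      fun x => ((v₃ ![x 0, x 1] : ℝ) : ℂ) := by
    funext x; simp [shearData]
  -- the first component has no modes with `k 0 ≠ 0`, the third none with `k 2 ≠ 0`
  have hz0 : (k 0 : ℂ) * mFourierCoeff (fun x : 𝕋³ => ((v₁ (x 1) : ℝ) : ℂ)) k = 0 := by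
    by_cases hk : k 0 = 0
    · simp [hk]
    · rw [Literature.Analysis.FunctionSpaces.Torus.mFourierCoeff_eq_zero_of_forall_add_single (i := 0) (fun s x => by simp) hk,
        mul_zero]
  have hz2 : (k 2 : ℂ) * mFourierCoeff (fun x : 𝕋³ => ((v₃ ![x 0, x 1] : ℝ) : ℂ)) k = 0 := by
    by_cases hk : k 2 = 0
    · simp [hk]
    · rw [Literature.Analysis.FunctionSpaces.Torus.mFourierCoeff_eq_zero_of_forall_add_single (i := 2) (fun s x => by simp) hk,
        mul_zero]
  rw [Fin.sum_univ_three, Literature.Analysis.FunctionSpaces.Torus.mFourierCoeff_apply_euclidean hint,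
    Literature.Analysis.FunctionSpaces.Torus.mFourierCoeff_apply_euclidean hint, Literature.Analysis.FunctionSpaces.Torus.mFourierCoeff_apply_euclidean hint, hc0, hc1,
    hc2, hz0, hz2]
  simp [mFourierCoeff]

/-! ## Part (i): existence, proved from Hopf's theorem -/

/-- **Bardos–Titi–Wiedemann 2012, Thm. 5, part (i) (existence), proved.** For shear data
`v₀ = (v₁(x₂), 0, v₃(x₁,x₂))` with `v₁ ∈ L²(T)`, `v₃ ∈ L²(T²)`, every `T > 0` and every
viscosity `ν > 0`, there is a Leray–Hopf weak solution of the unforced Navier–Stokes equations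
on `T³ × [0,T)` with datum `v₀`. The source obtains it from the two-and-a-half-dimensional
ansatz; here it is the special case `f = 0`, `u₀ = v₀` of Hopf's existence theorem on `T³`
(Hopf 1951; `NS.hopf_existence_torus_holds`, proved in the tree), the datum being admissible by
`memLp_shearData` and `isWeaklyDivFree_shearData`. [cite: BardosTitiWiedemann2012, Thm. 5] -/
theorem BardosTitiWiedemann2012_thm5_existence (v₁ : UnitAddCircle → ℝ) (hv₁ : MemLp v₁ 2 volume)
    (v₃ : 𝕋² → ℝ) (hv₃ : MemLp v₃ 2 volume) {T : ℝ} (hT : 0 < T) {ν : ℝ} (hν : 0 < ν) :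
    ∃ u : ℝ → 𝕋³ → E³, Literature.Analysis.FluidPDE.Torus.IsLerayHopfOn T ν 0 (shearData v₁ v₃) u := by
  have hf : AEStronglyMeasurable (Literature.Analysis.FunctionSpaces.Torus.stLift (0 : ℝ → 𝕋³ → E³))
      (volume.restrict (Ioi 0 ×ˢ univ)) :=
    aestronglyMeasurable_const (b := (0 : E³))
  obtain ⟨u, hu⟩ := Literature.Analysis.FluidPDE.hopf_existence_torus_holds ν hν (shearData v₁ v₃) (memLp_shearData hv₁ hv₃)
    (isWeaklyDivFree_shearData hv₁ hv₃) 0 hf (fun T' _ => by simp)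
  exact ⟨u, hu T hT⟩

/-! ## Parts (ii) and the structural claim of the printed proof, as named facts -/

/-- **Bardos–Titi–Wiedemann 2012, Thm. 5, part (ii) (uniqueness among all Leray–Hopf
solutions)**, named fact. For shear data `v₀ = (v₁(x₂), 0, v₃(x₁,x₂))`, `v₁ ∈ L²(T)`,
`v₃ ∈ L²(T²)`, `T > 0` and `ν > 0`, any two Leray–Hopf weak solutions of the unforced
Navier–Stokes equations on `T³ × [0,T)` with viscosity `ν` and datum `v₀` agree a.e. on every
time slice `t ∈ (0,T]` ("there exists a unique Leray-Hopf weak solution"; "Following ideas from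
[Serrin] (see, e.g., [BLNNT] and [Iftimie-Raugel] for details) one can show that this solution is
unique within the class of all 3D Leray-Hopf weak solutions", op. cit., Thm. 5 and its proof).
The indicated proof is Serrin's cross-testing argument (Serrin 1963, Thm. 6) with the trilinear
term controlled *off* the Prodi–Serrin scale by the anisotropic two-dimensional Ladyzhenskaya
inequality for an `x₃`-independent reference solution (Bardos–Lopes Filho–Niu–Nussenzveig
Lopes–Titi 2013, Thm. 3.1 and Rem. 3.1, printed for `D × (0,L)` with `D ⊂ ℝ²` a bounded smooth
domain, periodic in `x₃`; the note applies it on `T³`). Exactly the second conjunct of part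
(i)–(ii) of `BardosTitiWiedemann2012_thm5`. A THEOREM of the tree:
`BardosTitiWiedemann2012_thm5_uniqueness_holds` (`ShearFlowViscositySelectionStepsProofs`, from
`Torus.lerayHopf_ae_eq_of_invariant_datum`; axioms `propext`, `Classical.choice`, `Quot.sound`). [cite: BardosTitiWiedemann2012, Thm. 5] [cite: BardosEtAl2013, Thm. 3.1 and Rem. 3.1] -/
def BardosTitiWiedemann2012_thm5_uniqueness : Prop :=
  ∀ (v₁ : UnitAddCircle → ℝ) (_hv₁ : MemLp v₁ 2 volume) (v₃ : 𝕋² → ℝ) (_hv₃ : MemLp v₃ 2 volume)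
    (T : ℝ) (_hT : 0 < T) (ν : ℝ) (_hν : 0 < ν) (u u' : ℝ → 𝕋³ → E³),
    Literature.Analysis.FluidPDE.Torus.IsLerayHopfOn T ν 0 (shearData v₁ v₃) u →
      Literature.Analysis.FluidPDE.Torus.IsLerayHopfOn T ν 0 (shearData v₁ v₃) u' → ∀ t ∈ Ioc 0 T, u t =ᵐ[volume] u' t

/-- **The two-and-a-half-dimensional ansatz yields a Leray–Hopf solution** (Bardos–Titi–Wiedemann
2012, proof of Thm. 5), named fact. For shear data `v₀ = (v₁(x₂), 0, v₃(x₁,x₂))`, `v₁ ∈ L²(T)`,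
`v₃ ∈ L²(T²)`, `T > 0` and `ν > 0`, there is a Leray–Hopf weak solution of the unforced
Navier–Stokes equations on `T³ × [0,T)` with viscosity `ν` and datum `v₀` of the form
`u^ν(x,t) = (u₁^ν(x₂,t), 0, u₃^ν(x₁,x₂,t))`: "The intuition that the solution of Navier-Stokes
should preserve the particular structure of the initial data leads us to the ansatz … Inserting
this into the Navier-Stokes equations gives the so called two-and-half Navier-Stokes equations …
which is known to be globally well-posed for this kind of initial data (see, e.g., [DM] …) …
Hence, for every fixed `ν > 0`, we obtain a Leray-Hopf weak solution with the initial data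
`v₀(x)`" (op. cit., proof of Thm. 5: the heat equation for `u₁^ν` with datum `v₁`, an
advection–diffusion equation for `u₃^ν` with datum `v₃ ∈ L²`, solved in
`L²([0,T];H¹(T²)) ∩ C([0,T];L²(T²))` by standard parabolic theory, Evans, §7.1.3, Thm. 5).
Only the structure is recorded (paper coordinates `x₁,x₂,x₃` ↦ indices `0,1,2`); that `u₁^ν`
is the heat flow of `v₁` follows from it and the weak formulation. A THEOREM of the tree:
`BardosTitiWiedemann2012_thm5_shearLerayHopf_holds` (`ShearFlowViscositySelectionStepsProofs`;
axioms `propext`, `Classical.choice`, `Quot.sound`). [cite: BardosTitiWiedemann2012, Thm. 5, proof] [cite: DiPernaMajda1987] -/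
def BardosTitiWiedemann2012_thm5_shearLerayHopf : Prop :=
  ∀ (v₁ : UnitAddCircle → ℝ) (_hv₁ : MemLp v₁ 2 volume) (v₃ : 𝕋² → ℝ) (_hv₃ : MemLp v₃ 2 volume)
    (T : ℝ) (_hT : 0 < T) (ν : ℝ) (_hν : 0 < ν),
    ∃ (a : ℝ → UnitAddCircle → ℝ) (c : ℝ → 𝕋² → ℝ),
      Literature.Analysis.FluidPDE.Torus.IsLerayHopfOn T ν 0 (shearData v₁ v₃) fun t x => !₂[a t (x 1), 0, c t ![x 0, x 1]]

/-- **Parts (i)–(ii) of Thm. 5 assembled**: existence (proved, `BardosTitiWiedemann2012_thm5_existence`)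
and uniqueness (the named fact `BardosTitiWiedemann2012_thm5_uniqueness`) give, for every `ν > 0`,
a Leray–Hopf solution with shear datum, unique among all Leray–Hopf solutions — the first
conjunct of `BardosTitiWiedemann2012_thm5` verbatim (Bardos–Titi–Wiedemann 2012, Thm. 5). [cite: BardosTitiWiedemann2012, Thm. 5] -/
theorem BardosTitiWiedemann2012_thm5_wellposed (huniq : BardosTitiWiedemann2012_thm5_uniqueness)
    (v₁ : UnitAddCircle → ℝ) (hv₁ : MemLp v₁ 2 volume) (v₃ : 𝕋² → ℝ) (hv₃ : MemLp v₃ 2 volume)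
    (T : ℝ) (hT : 0 < T) :
    ∀ ν : ℝ, 0 < ν →
      (∃ u : ℝ → 𝕋³ → E³, Literature.Analysis.FluidPDE.Torus.IsLerayHopfOn T ν 0 (shearData v₁ v₃) u) ∧
      ∀ u u' : ℝ → 𝕋³ → E³, Literature.Analysis.FluidPDE.Torus.IsLerayHopfOn T ν 0 (shearData v₁ v₃) u →
        Literature.Analysis.FluidPDE.Torus.IsLerayHopfOn T ν 0 (shearData v₁ v₃) u' → ∀ t ∈ Ioc 0 T, u t =ᵐ[volume] u' t :=
  fun _ν hν => ⟨BardosTitiWiedemann2012_thm5_existence v₁ hv₁ v₃ hv₃ hT hν,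
    huniq v₁ hv₁ v₃ hv₃ T hT _ hν⟩

/-- **The structural solution is the Leray–Hopf solution** (given uniqueness): under the two
named facts, every Leray–Hopf solution with shear datum agrees a.e. on every slice `t ∈ (0,T]`
with one of the ansatz form `(u₁(x₂,t), 0, u₃(x₁,x₂,t))` (Bardos–Titi–Wiedemann 2012, proof of
Thm. 5). [cite: BardosTitiWiedemann2012, Thm. 5, proof] -/
theorem BardosTitiWiedemann2012_thm5_uniqueness.ae_eq_shear
    (huniq : BardosTitiWiedemann2012_thm5_uniqueness)
    (hshear : BardosTitiWiedemann2012_thm5_shearLerayHopf)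
    {v₁ : UnitAddCircle → ℝ} (hv₁ : MemLp v₁ 2 volume) {v₃ : 𝕋² → ℝ} (hv₃ : MemLp v₃ 2 volume)
    {T : ℝ} (hT : 0 < T) {ν : ℝ} (hν : 0 < ν) {u : ℝ → 𝕋³ → E³}
    (hu : Literature.Analysis.FluidPDE.Torus.IsLerayHopfOn T ν 0 (shearData v₁ v₃) u) :
    ∃ (a : ℝ → UnitAddCircle → ℝ) (c : ℝ → 𝕋² → ℝ),
      Literature.Analysis.FluidPDE.Torus.IsLerayHopfOn T ν 0 (shearData v₁ v₃) (fun t x => !₂[a t (x 1), 0, c t ![x 0, x 1]]) ∧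
      ∀ t ∈ Ioc 0 T, u t =ᵐ[volume] fun x => !₂[a t (x 1), 0, c t ![x 0, x 1]] := by
  obtain ⟨a, c, hac⟩ := hshear v₁ hv₁ v₃ hv₃ T hT ν hν
  exact ⟨a, c, hac, huniq v₁ hv₁ v₃ hv₃ T hT ν hν u _ hu hac⟩

end Literature.Barriers.AnomalousDissipation

end
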